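import Literature.MathematicalPhysics.QuantumFieldTheory.Balaban1983to89.B8Prop6CubeMemberBdryP
import Literature.MathematicalPhysics.QuantumFieldTheory.Balaban1983to89.B8Prop6CubeMemberGaugedBdry

/-!
# `Balaban1983to89.B8Prop6CubeMemberGaugedBdryP` — [Balaban1985RegularSpaces] PROPOSITION 6 (p. 99) AT EVERY CUBE OF (1.131) FROM THEOREM 4 AS PRINTED
# ON THE CUBE SUB-FAMILY AND THE FOUR-LINE PROP.-3-FRAME SOCKET IN THE CURRENCY R-d′ (collar over all touching sides not fully inside `□₀`)

statement-level skeleton of published theorems with citation tags; proofs where landed; nothing here is a claim about the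
Yang–Mills mass gap

PDF held: `paper:balaban1985-cmp99-regular-spaces-gauge-fixing`; pp. 77, 81, 83, 86–88, 98–99.

CITATION HEADER (lean-in-tree rule).  Cell `pub-ymgap` (D-0062), node N05 = [B8], seat `pub-ymgap-dag-n05-e` g7 (R141 (C) row s3b).  WHY: this seat's
g6∕g7 p6 letters (`B8Prop6CubeMemberGaugedBdry`, `B8Prop6CubeMemberBdry4`) read the Prop.-3-frame socket in the currency R-d, located unsatisfiable at
finite `Ω₀` (boundary-bond mode, dag-n06-b CANDIDATE-3, bus l.20491).  `B8Prop6CubeMemberBdryP` (this seat) re-runs the norm members in the currency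
R-d′ (collar over outer sides AND boundary bonds).  THIS FILE re-runs the two compositions on it: ★ `gaugedBoundB8_cubeMember_of_thm4_b9DP_d4`
(g6's `gaugedBoundB8_cubeMember_of_thm4_b9D` proof verbatim with the R-d′ norms theorem), ★ `prop6Printed_zdCub_of_thm4_b9DP_d4` — Proposition 6's knit
letter on `zdCub ∘ f` from THEOREM 4 AS PRINTED on the cube sub-family (named hypothesis `H4`, the printed-currency road of g6 `B8Prop6CubeMemberOfPrinted`)
and the per-cube four-line R-d′ socket.  Kind «kernel-checked proof», theorems only, no `def`.

HONEST SCOPE.  (i) `H4` = Theorem 4 as printed on the cube sub-family is a HYPOTHESIS (its tree provider `thm4Printed_zd3_map_bdry` reads `SH59D` in the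
refuted currency R-d; the R-d′ Theorem-4 chain is NOT re-run here); the per-cube R-d′ socket is a HYPOTHESIS ([4] Thm 3.3 for `G(1)`, `H(1)` on the finite
cube family WITH exterior data), not discharged, not hit by the two located modes.  (ii) `B_∂ ≥ 0`, `4B_∂ ≤ (dL − 1)B₀` are the tree's.  Count-neutral;
N05 NOT discharged; one finite `𝕋⁴` programme at fixed `ε`, Bałaban as printed; nothing continuum ∕ ℝ⁴ ∕ OS ∕ mass-gap ∕ Clay.  No `sorry`, no `def`,
no `instance`, no `notation`.  Unit `pub-ymgap-dag-n05-e` (g7), 2026-08-27.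
-/

noncomputable section

open NormedSpace

namespace Literature.MathematicalPhysics.QuantumFieldTheory.Balaban1983to89.B8Prop6CubeMemberGaugedBdryP

open MatrixLog B7Prop1Explicit B7Prop2Explicit B7Prop1Local B7Eq92Concrete
open B7Prop3Flat (c3)
open B7Prop4GeneralLevels (logCovIter linCovIter)
open B8Ineq132 (InAk inAk_gaugeAct_iff pdevOn_lt_of_inAk covDerivFwd BondTouches)
open B8Ineq133 (cutFixed)
open B8Eq115GaugeFixing (localGauge gaugeAct_mem_of)
open B8Eq119TwistedAxial (Restr129 InAx)
open B8Eq140Level (SideTouches)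
open B8Eq146AExpansion (iEta plaqCovDeriv)
open B8Eq143PlaqExpansion (pdiv)
open B8Eq155JBound (Jcur wsup)
open B8ScaledSupNorm (bondNorm msup)
open B8Eq184Proof (cfgExp)
open B8Eq138LandauZd (IsLandau138W logCfg covLap)
open B8Eq131Cubes (tcube tLo tHi ctr tLo_le_tHi)
open B8Eq131CubesAdmissible (cubeFam)
open B8CubeMemberZd (cubeLamS cubeLamB hΩ_cubeFam hbox_cubeLamB hclass_cubeLamB htower_cubeLam hpart_cubeLam)
open B8Prop6CubeMember (thm4_hypotheses_one_cutFixed)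
open B8Lemma1NonAbelian (mulCfg)
open B8Prop6OfThm4 (const_136 smallness_134 localGauge_mem agree135)
open B8LeafModelZd (ZdIdx SockP5base SockP5 SockP5u)
open B8LeafModelZd3 (mlogCfg zdGF3)
open B8Prop6CubeMemberNormsAt (windows136_of_small)
open B8Prop6CubeMemberGauged (gaugedBoundB8_of_clauses)
open B8Prop3GaugeFixedKLevel (mem_unitaryUnits_of_mgauge_eq)
open B8Thm4AtLandau138 (mgauge_mgauge_inv)
open Node00 (CubeB8 GaugedBoundB8 zdCub prop6Printed_zdCub_iff)

-- `Site` alone could resolve to the torus sites of `Setup.lean`; re-export the `ℤ^d` sites of `B7Prop1Explicit`.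
export B7Prop1Explicit (Site)

variable {d : ℕ}

variable {𝔸 : Type} [CStarAlgebra 𝔸] [Nontrivial 𝔸]
open B8Prop6CubeMemberBdryP (norms136_cubeMember_at_bdryP_d4)

/-! ## §1 (1.135)–(1.138) at every cube from Theorem 4 as printed on the cube sub-family + the FOUR-LINE R-d′ socket at the cube -/

/-- ★ **PROPOSITION 6 (p. 99), (1.135)–(1.138) AS `Node00.GaugedBoundB8` AT EVERY CUBE, FROM THEOREM 4 AS PRINTED ON THE CUBE SUB-FAMILY AND THE
FOUR-LINE PROP.-3-FRAME b9 SOCKET IN THE CURRENCY R-d′** — g6's `gaugedBoundB8_cubeMember_of_thm4_b9D` with the socket binder in the currency R-d′ (four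
lines; collar allowance over ALL touching sides not fully inside `□₀`); the norm members come from `B8Prop6CubeMemberBdryP.norms136_cubeMember_at_bdryP_d4`.
[cite: Balaban1985RegularSpaces, Prop. 6 (1.135)–(1.138) p.99, Thm 4 p.88, Prop. 3 p.87, (1.58)–(1.59) p.86, (1.29) p.81] -/
theorem gaugedBoundB8_cubeMember_of_thm4_b9DP_d4 (hd2 : 2 ≤ d) {L : ℕ} (hL : 2 ≤ L) (inp : B8.B9Inputs) {C₂ cB9 Bbd : ℝ}
    (hC₂ : 2097152 * ((d : ℝ) + 1) ^ 2 ≤ C₂) (hcB9 : 0 < cB9) (hBbd : 0 ≤ Bbd) (hBd : 4 * Bbd ≤ ((d : ℝ) * L - 1) * inp.B₀)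
    (β : ℝ) (len : Site d → ℝ)
    (H4 : B8.Thm4Printed (5 * (d : ℝ) * L * inp.B₀)
      (fun i : {i : ZdIdx d L // ∃ (a : Site d) (M ρ : ℕ), L ≤ ρ ∧ ρ ≤ M ∧ 11 * d < M ∧ L ≤ d * M ∧
        i.Ω = cubeFam false L a M ρ i.k ∧ i.Λs = cubeLamS L a M ρ i.k ∧ i.Λb = cubeLamB L a M ρ i.k} => (zdGF3 𝔸 L β len i.1).toGFData)) :
    ∃ c₁ : ℝ, 0 < c₁ ∧ ∀ (η : ℝ), 0 < η → ∀ {K : ℕ} {Ω : ℕ → Set (Site d)} (c : CubeB8 d L K Ω),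
      -- the Prop.-3-frame b9 socket AT THE CUBE, IN THE CURRENCY R-d′ — FOUR LINES, collar over ALL touching sides NOT FULLY INSIDE `□₀`
      (∀ α₀ α₂ : ℝ, 0 < α₀ → α₀ ≤ cB9 → 0 < α₂ → α₂ ≤ cB9 →
      ∀ (U₀ W : Site d → Fin d → 𝔸ˣ), (∀ x κ, U₀ x κ ∈ unitaryUnits 𝔸) → (∀ x κ, W x κ ∈ unitaryUnits 𝔸) →
      InAk L c.k η α₀ (cubeFam false L c.a c.M c.ρ c.k) U₀ → InAk L c.k η α₀ (cubeFam false L c.a c.M c.ρ c.k) (mulCfg W U₀) → IsLandau138W L c.k η ((cubeFam false L c.a c.M c.ρ c.k) 0) (cubeLamS L c.a c.M c.ρ c.k c.k) U₀ W →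
      ∀ A' : Site d → Fin d → 𝔸, (∀ y τ, IsSelfAdjoint (A' y τ)) →
      (∀ j, j ≤ c.k → ∀ (y : Site d) (τ : Fin d), SideTouches ((cubeFam false L c.a c.M c.ρ c.k) j) y τ →
      W y τ = cfgExp η A' y τ ∧ ‖A' y τ‖ ≤ α₂ * ((L : ℝ) ^ j * η)⁻¹) →
      (∀ (y : Site d) (τ : Fin d), (∀ j, j ≤ c.k → ¬ SideTouches ((cubeFam false L c.a c.M c.ρ c.k) j) y τ) → A' y τ = 0) →
      msup L c.k η (-(1 : ℝ)) (fun j (b : Site d × Fin d) => SideTouches ((cubeFam false L c.a c.M c.ρ c.k) j) b.1 b.2) (fun b => A' b.1 b.2)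
      ≤ inp.B₀ * (bondNorm L c.k η (-(3 : ℝ)) (cubeFam false L c.a c.M c.ρ c.k) (fun x μ => Jcur η U₀ A' μ x)
      + wsup 1 (fun p : {p : ℕ × (Site d × Fin d) // p.1 ≤ c.k ∧ p.2 ∈ cubeLamB L c.a c.M c.ρ c.k c.k p.1} =>
      linCovIter L U₀ (iEta η A') p.1.1 p.1.2.1 p.1.2.2)) + Bbd * msup L c.k η (-(1 : ℝ))
      (fun j (b : Site d × Fin d) => j = 0 ∧ SideTouches ((cubeFam false L c.a c.M c.ρ c.k) 0) b.1 b.2 ∧ ¬ (b.1 ∈ (cubeFam false L c.a c.M c.ρ c.k) 0 ∧ b.1 + e b.2 ∈ (cubeFam false L c.a c.M c.ρ c.k) 0))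
      (fun b => A' b.1 b.2) ∧
      msup L c.k η (-(2 : ℝ)) (fun j (t : Fin d × Fin d × Site d) => SideTouches ((cubeFam false L c.a c.M c.ρ c.k) j) t.2.2 t.2.1)
      (fun t => covDerivFwd η U₀ t.1 (fun z => A' z t.2.1) t.2.2)
      ≤ inp.B₀ * (bondNorm L c.k η (-(3 : ℝ)) (cubeFam false L c.a c.M c.ρ c.k) (fun x μ => Jcur η U₀ A' μ x)
      + wsup 1 (fun p : {p : ℕ × (Site d × Fin d) // p.1 ≤ c.k ∧ p.2 ∈ cubeLamB L c.a c.M c.ρ c.k c.k p.1} =>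
      linCovIter L U₀ (iEta η A') p.1.1 p.1.2.1 p.1.2.2)) + Bbd * msup L c.k η (-(1 : ℝ))
      (fun j (b : Site d × Fin d) => j = 0 ∧ SideTouches ((cubeFam false L c.a c.M c.ρ c.k) 0) b.1 b.2 ∧ ¬ (b.1 ∈ (cubeFam false L c.a c.M c.ρ c.k) 0 ∧ b.1 + e b.2 ∈ (cubeFam false L c.a c.M c.ρ c.k) 0))
      (fun b => A' b.1 b.2) ∧
      bondNorm L c.k η (-(3 : ℝ)) (cubeFam false L c.a c.M c.ρ c.k) (fun x μ => pdiv η U₀ (plaqCovDeriv η U₀ A') μ x)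
      ≤ inp.B₀ * (bondNorm L c.k η (-(3 : ℝ)) (cubeFam false L c.a c.M c.ρ c.k) (fun x μ => Jcur η U₀ A' μ x)
      + wsup 1 (fun p : {p : ℕ × (Site d × Fin d) // p.1 ≤ c.k ∧ p.2 ∈ cubeLamB L c.a c.M c.ρ c.k c.k p.1} =>
      linCovIter L U₀ (iEta η A') p.1.1 p.1.2.1 p.1.2.2)) + Bbd * msup L c.k η (-(1 : ℝ))
      (fun j (b : Site d × Fin d) => j = 0 ∧ SideTouches ((cubeFam false L c.a c.M c.ρ c.k) 0) b.1 b.2 ∧ ¬ (b.1 ∈ (cubeFam false L c.a c.M c.ρ c.k) 0 ∧ b.1 + e b.2 ∈ (cubeFam false L c.a c.M c.ρ c.k) 0))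
      (fun b => A' b.1 b.2) ∧
      bondNorm L c.k η (-(3 : ℝ)) (cubeFam false L c.a c.M c.ρ c.k) (fun x μ => covLap η U₀ (fun z => A' z μ) x)
      ≤ inp.B₀ * (bondNorm L c.k η (-(3 : ℝ)) (cubeFam false L c.a c.M c.ρ c.k) (fun x μ => Jcur η U₀ A' μ x)
      + wsup 1 (fun p : {p : ℕ × (Site d × Fin d) // p.1 ≤ c.k ∧ p.2 ∈ cubeLamB L c.a c.M c.ρ c.k c.k p.1} =>
      linCovIter L U₀ (iEta η A') p.1.1 p.1.2.1 p.1.2.2)) + Bbd * msup L c.k η (-(1 : ℝ))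
      (fun j (b : Site d × Fin d) => j = 0 ∧ SideTouches ((cubeFam false L c.a c.M c.ρ c.k) 0) b.1 b.2 ∧ ¬ (b.1 ∈ (cubeFam false L c.a c.M c.ρ c.k) 0 ∧ b.1 + e b.2 ∈ (cubeFam false L c.a c.M c.ρ c.k) 0))
      (fun b => A' b.1 b.2)) →
      ∀ (U₀ : Site d → Fin d → 𝔸ˣ), (∀ x κ, U₀ x κ ∈ unitaryUnits 𝔸) → ∀ (α₀ : ℝ), 0 < α₀ → InAk L K η α₀ Ω U₀ →
      7 * d * (L : ℝ) ^ 2 * c.M * α₀ ≤ c₁ →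
      GaugedBoundB8 L η U₀ c (7 * d * (L : ℝ) ^ 2 * (5 * (d : ℝ) * L * inp.B₀) * c.M * α₀) := by
  have hL1 : 1 ≤ L := le_trans (by norm_num) hL
  have hd1 : 1 ≤ d := le_trans (by norm_num) hd2
  have hLpos : (0 : ℝ) < L := by exact_mod_cast hL1
  have hdpos : (0 : ℝ) < d := by exact_mod_cast hd1
  have hB₀ : 0 < inp.B₀ := inp.B₀_pos
  obtain ⟨c₄, hc₄, T4⟩ := H4
  obtain ⟨c₃, hc₃, N3⟩ := norms136_cubeMember_at_bdryP_d4 (𝔸 := 𝔸) hd2 hL hB₀ hC₂ hcB9 hBbd hBd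
  have hC₂0 : 0 ≤ C₂ := le_trans (by positivity) hC₂
  obtain ⟨cW, hcW, W⟩ := windows136_of_small hd2 hL hB₀ hC₂0 hc₃
  set B : ℝ := 5 * (d : ℝ) * L * inp.B₀ with hB_def
  have hB0 : 0 < B := by positivity
  set C : ℝ := 131072 * ((d : ℝ) + 1) ^ 2 with hC_def
  have hC0 : 0 < C := by positivity
  refine ⟨min c₄ (min cW (1 / (16 * C * B))), lt_min hc₄ (lt_min hcW (by positivity)), ?_⟩
  intro η hη K Ω c SB9D U₀ hU₀ α₀ hα hAK hs
  -- the cube's laws as datum binders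
  have hk : 1 ≤ c.k := c.one_le_k
  have hρL : L ≤ c.ρ := c.L_le_ρ
  have hρM : c.ρ ≤ c.M := c.ρ_le_M
  have hρ : 1 ≤ c.ρ := hL1.trans hρL
  have hM1 : 1 ≤ c.M := hρ.trans hρM
  have hM : 11 * (d : ℝ) < c.M := by exact_mod_cast c.big
  have hLdM : (L : ℝ) ≤ d * c.M := by exact_mod_cast c.L_le_dM
  have hA : InAk L c.k η α₀ Ω U₀ := c.inAk hAK
  have hs₄ : 7 * d * (L : ℝ) ^ 2 * c.M * α₀ ≤ c₄ := hs.trans (min_le_left _ _)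
  have hsW : 7 * d * (L : ℝ) ^ 2 * c.M * α₀ ≤ cW := hs.trans ((min_le_right _ _).trans (min_le_left _ _))
  have hsC : 7 * d * (L : ℝ) ^ 2 * c.M * α₀ ≤ 1 / (16 * C * B) := hs.trans ((min_le_right _ _).trans (min_le_right _ _))
  -- every window from «7dL²Mα₀ ≤ c₁»
  obtain ⟨⟨hα3, hα2, hsmall⟩, ⟨hα₀c, hα₁c, hα₂c⟩, h61, ⟨-, -, h16, -, hc3α, hsmall₁⟩, h12⟩ := W c.M c.ρ hM1 hρM hM hLdM α₀ hα hsW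
  -- the shifted smallness pair `(α₀′, α₁′) = (L³α₀, 6dL²Mα₀)` and `t = α₀′ + α₁′`
  have hα₀' : 0 < (L : ℝ) ^ 3 * α₀ := by positivity
  have hMpos : (0 : ℝ) < c.M := by exact_mod_cast hM1
  have hα₁' : 0 < 6 * d * (L : ℝ) ^ 2 * c.M * α₀ := by positivity
  have ht₄ : (L : ℝ) ^ 3 * α₀ + 6 * d * (L : ℝ) ^ 2 * c.M * α₀ ≤ c₄ := smallness_134 hLpos hα hLdM hs₄
  have htpos : 0 < (L : ℝ) ^ 3 * α₀ + 6 * d * (L : ℝ) ^ 2 * c.M * α₀ := add_pos hα₀' hα₁'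
  have hα₂pos : 0 < B * ((L : ℝ) ^ 3 * α₀ + 6 * d * (L : ℝ) ^ 2 * c.M * α₀) := mul_pos hB0 htpos
  -- «the assumptions of Theorem 4 are satisfied for the pair 1, U₀″» (n05-c)
  obtain ⟨hmem, h33, h34, hAx, h135b, h66⟩ :=
    thm4_hypotheses_one_cutFixed L hL hd1 c.k U₀ hU₀ hα hα3 hα2 c.a hρ hρM hM hη hA c.tcube_sub hsmall
  set U'' := cutFixed L (tLo c.a c.ρ) (tHi c.a c.M c.ρ) U₀ c.k (ctr c.a c.M) with hU''
  have hone : ∀ x κ, (1 : Site d → Fin d → 𝔸ˣ) x κ ∈ unitaryUnits 𝔸 := fun _ _ => (unitaryUnits 𝔸).one_mem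
  -- the member `{□_j}` of the cube sub-family
  set ic : ZdIdx d L := ⟨η, hη, c.k, hk, cubeFam false L c.a c.M c.ρ c.k, hΩ_cubeFam hL1 c.a c.M hρL c.k, cubeLamS L c.a c.M c.ρ c.k,
    cubeLamB L c.a c.M c.ρ c.k, hbox_cubeLamB L c.a c.M c.ρ c.k, hclass_cubeLamB L c.a c.M c.ρ c.k, htower_cubeLam hL1 c.a c.M c.ρ c.k,
    hpart_cubeLam hL1 c.a c.M c.ρ c.k⟩ with hic_def
  have hic : ∃ (a : Site d) (M ρ : ℕ), L ≤ ρ ∧ ρ ≤ M ∧ 11 * d < M ∧ L ≤ d * M ∧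
      ic.Ω = cubeFam false L a M ρ ic.k ∧ ic.Λs = cubeLamS L a M ρ ic.k ∧ ic.Λb = cubeLamB L a M ρ ic.k :=
    ⟨c.a, c.M, c.ρ, hρL, hρM, c.big, c.L_le_dM, rfl, rfl, rfl⟩
  -- THEOREM 4 at the member, for the datum `(1, U₀″)` at `(α₀′, α₁′)`
  obtain ⟨u, hR, ⟨h137, hLan, h162⟩, -⟩ :=
    T4 ⟨ic, hic⟩ ((L : ℝ) ^ 3 * α₀) (6 * d * (L : ℝ) ^ 2 * c.M * α₀) hα₀' hα₁' ht₄ ⟨1, hone⟩ (⟨1, hone⟩, ⟨U'', hmem⟩) h33 trivial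
      ⟨rfl, h34, hAx⟩ ⟨h135b, h66⟩
  have hu : ∀ x, u.1 x ∈ unitaryUnits 𝔸 := u.2.1
  have huS : ∀ x, x ∉ cubeFam false L c.a c.M c.ρ c.k 0 → u.1 x = 1 := u.2.2
  have h129 : Restr129 L c.k (cubeLamS L c.a c.M c.ρ c.k c.k) (1 : Site d → Fin d → 𝔸ˣ) u.1 := hR
  -- the gauge-fixed field `U₁ = U₀″^{u⁻¹}` (at background `1` the moving-frame action is the ordinary gauge action)
  have hW : mgauge (1 : Site d → Fin d → 𝔸ˣ) u.1 (mgauge (1 : Site d → Fin d → 𝔸ˣ) u.1⁻¹ U'') = U'' := mgauge_mgauge_inv _ U'' u.1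
  have hWu : ∀ x κ, mgauge (1 : Site d → Fin d → 𝔸ˣ) u.1⁻¹ U'' x κ ∈ unitaryUnits 𝔸 := mem_unitaryUnits_of_mgauge_eq hone hmem hu hW
  have hLan' : IsLandau138W L c.k η (cubeFam false L c.a c.M c.ρ c.k 0) (cubeLamS L c.a c.M c.ρ c.k c.k) (1 : Site d → Fin d → 𝔸ˣ)
      (gaugeAct u.1⁻¹ U'') := by
    have h := hLan
    simp only [zdGF3, mgauge_one_left] at h
    exact h
  have h162' : ∀ j, j ≤ c.k → ∀ b ∈ {b : Site d × Fin d | SideTouches (cubeFam false L c.a c.M c.ρ c.k j) b.1 b.2},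
      gaugeAct u.1⁻¹ U'' b.1 b.2 = cfgExp η (logCfg η (gaugeAct u.1⁻¹ U'')) b.1 b.2 ∧
        IsSelfAdjoint (logCfg η (gaugeAct u.1⁻¹ U'') b.1 b.2) ∧
        ‖logCfg η (gaugeAct u.1⁻¹ U'') b.1 b.2‖ ≤
          (5 * (d : ℝ) * L * inp.B₀ * ((L : ℝ) ^ 3 * α₀ + 6 * d * (L : ℝ) ^ 2 * c.M * α₀)) * ((L : ℝ) ^ j * η)⁻¹ := by
    have h := h162
    simp only [zdGF3, mgauge_one_left] at h
    exact h
  -- PROPOSITION 3's norm members at the member FROM THE R-d′ b9 SOCKET AT THE CUBE (this seat's `norms136_cubeMember_at_bdryP_d4`)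
  obtain ⟨h136g, h139j, h139l⟩ := N3 η hη c.k hk c.a c.M c.ρ hρL hρM hM SB9D U₀ hU₀ α₀ hα hα3 hα2 Ω hA c.tcube_sub hsmall hα₀c hα₂c
    h61 hsmall₁ u.1 hu huS h129 hLan' h162'
  -- the three norm members of (1.136), with print's constant (`const_136`)
  have hconst : B * ((L : ℝ) ^ 3 * α₀ + 6 * d * (L : ℝ) ^ 2 * c.M * α₀) ≤ 7 * d * (L : ℝ) ^ 2 * B * c.M * α₀ :=
    const_136 hLpos hα hB0.le hLdM
  have h136₂ : B8ScaledSupNorm.msup L c.k η (-(2 : ℝ)) (fun j (t : Fin d × Fin d × Site d) => SideTouches (cubeFam false L c.a c.M c.ρ c.k j) t.2.2 t.2.1)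
      (fun t => B8Ineq132.covDerivFwd η (1 : Site d → Fin d → 𝔸ˣ) t.1
        (fun z => mlogCfg c.k η (cubeFam false L c.a c.M c.ρ c.k) (gaugeAct u.1⁻¹ U'') z t.2.1) t.2.2) ≤
      7 * d * (L : ℝ) ^ 2 * (5 * (d : ℝ) * L * inp.B₀) * c.M * α₀ := by
    exact h136g.trans hconst
  have h136₃ : B8ScaledSupNorm.bondNorm L c.k η (-(3 : ℝ)) (cubeFam false L c.a c.M c.ρ c.k)
      (fun x μ => B8Eq143PlaqExpansion.pdiv η (1 : Site d → Fin d → 𝔸ˣ) (B8Eq146AExpansion.plaqCovDeriv η (1 : Site d → Fin d → 𝔸ˣ)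
        (mlogCfg c.k η (cubeFam false L c.a c.M c.ρ c.k) (gaugeAct u.1⁻¹ U''))) μ x) ≤
      7 * d * (L : ℝ) ^ 2 * (5 * (d : ℝ) * L * inp.B₀) * c.M * α₀ := by
    exact h139j.trans hconst
  have h136₄ : B8ScaledSupNorm.bondNorm L c.k η (-(3 : ℝ)) (cubeFam false L c.a c.M c.ρ c.k)
      (fun x μ => B8Eq138LandauZd.covLap η (1 : Site d → Fin d → 𝔸ˣ)
        (fun z => mlogCfg c.k η (cubeFam false L c.a c.M c.ρ c.k) (gaugeAct u.1⁻¹ U'') z μ) x) ≤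
      7 * d * (L : ℝ) ^ 2 * (5 * (d : ℝ) * L * inp.B₀) * c.M * α₀ := by
    exact h139l.trans hconst
  -- (1.135): `w = v⁻¹u` is unitary and `U₀^{w⁻¹} = U₁` on `□̃`
  have hΩ' : ∃ l, l ≤ c.k ∧ c.k ≤ l + 1 ∧ ∀ x, InBox (B8Ineq130.tlo L (tLo c.a c.ρ) c.k) (B8Ineq130.thi L (tHi c.a c.M c.ρ) c.k) x → x ∈ Ω l :=
    ⟨c.k - 1, Nat.sub_le _ _, by omega, fun x hx => c.tcube_sub hx⟩
  have hvG : ∀ x, localGauge L (tLo c.a c.ρ) (tHi c.a c.M c.ρ) U₀ c.k (ctr c.a c.M) x ∈ unitaryUnits 𝔸 :=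
    localGauge_mem L hL (avgClosed_unitaryUnits (𝔸 := 𝔸) d L) c.k U₀ hU₀ hα hα3 hα2 (tLo_le_tHi hM1)
      (pdevOn_lt_of_inAk hL1 hα hA hΩ') (ctr c.a c.M)
  have hw : ∀ x, ((localGauge L (tLo c.a c.ρ) (tHi c.a c.M c.ρ) U₀ c.k (ctr c.a c.M))⁻¹ * u.1) x ∈ unitaryUnits 𝔸 := fun x =>
    (unitaryUnits 𝔸).mul_mem ((unitaryUnits 𝔸).inv_mem (hvG x)) (hu x)
  have h135 := agree135 (B8Ineq130.tlo L (tLo c.a c.ρ) c.k) (B8Ineq130.thi L (tHi c.a c.M c.ρ) c.k) U₀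
    (localGauge L (tLo c.a c.ρ) (tHi c.a c.M c.ρ) U₀ c.k (ctr c.a c.M)) u.1
  -- the [3]-Prop.-4 window of the engine
  have h16C : 16 * (131072 * ((d : ℝ) + 1) ^ 2) * (B * ((L : ℝ) ^ 3 * α₀ + 6 * d * (L : ℝ) ^ 2 * c.M * α₀)) ≤ 1 := by
    have e2 : 7 * d * (L : ℝ) ^ 2 * B * c.M * α₀ = B * (7 * d * (L : ℝ) ^ 2 * c.M * α₀) := by ring
    have e3 : B * (7 * d * (L : ℝ) ^ 2 * c.M * α₀) ≤ B * (1 / (16 * C * B)) := mul_le_mul_of_nonneg_left hsC hB0.le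
    have e4 : B * (1 / (16 * C * B)) = 1 / (16 * C) := by field_simp
    have e5 : B * ((L : ℝ) ^ 3 * α₀ + 6 * d * (L : ℝ) ^ 2 * c.M * α₀) ≤ 1 / (16 * C) := by linarith [hconst, e3]
    calc 16 * (131072 * ((d : ℝ) + 1) ^ 2) * (B * ((L : ℝ) ^ 3 * α₀ + 6 * d * (L : ℝ) ^ 2 * c.M * α₀))
        ≤ 16 * C * (1 / (16 * C)) := mul_le_mul_of_nonneg_left e5 (by positivity)
      _ = 1 := by field_simp
  exact gaugedBoundB8_of_clauses hd2 hL hB₀ hη c U₀ hU₀ hα hA hα3 hα2 hsmall h12 h16C hc3α u.1 hu huS h129 hLan' h162' hw h135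
    h136₂ h136₃ h136₄



#print axioms gaugedBoundB8_cubeMember_of_thm4_b9DP_d4

/-- ★ **`B8.Prop6Printed d L (5dL·inp.B₀) c₁` ON `Node00.zdCub`, FROM THEOREM 4 AS PRINTED ON THE CUBE SUB-FAMILY AND THE FOUR-LINE R-d′ SOCKET AT
EVERY CUBE** (`gaugedBoundB8_cubeMember_of_thm4_b9DP_d4` through `Node00.prop6Printed_zdCub_iff`).
[cite: Balaban1985RegularSpaces, Prop. 6 p.99, Thm 4 p.88, Prop. 3 p.87, (1.59) p.86] -/
theorem prop6Printed_zdCub_of_thm4_b9DP_d4 (hd2 : 2 ≤ d) {L : ℕ} (hL : 2 ≤ L) (inp : B8.B9Inputs) {C₂ cB9 Bbd : ℝ}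
    (hC₂ : 2097152 * ((d : ℝ) + 1) ^ 2 ≤ C₂) (hcB9 : 0 < cB9) (hBbd : 0 ≤ Bbd) (hBd : 4 * Bbd ≤ ((d : ℝ) * L - 1) * inp.B₀)
    (β : ℝ) (len : Site d → ℝ)
    (H4 : B8.Thm4Printed (5 * (d : ℝ) * L * inp.B₀)
      (fun i : {i : ZdIdx d L // ∃ (a : Site d) (M ρ : ℕ), L ≤ ρ ∧ ρ ≤ M ∧ 11 * d < M ∧ L ≤ d * M ∧
        i.Ω = cubeFam false L a M ρ i.k ∧ i.Λs = cubeLamS L a M ρ i.k ∧ i.Λb = cubeLamB L a M ρ i.k} => (zdGF3 𝔸 L β len i.1).toGFData)) :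
    ∃ c₁ : ℝ, 0 < c₁ ∧ ∀ {ι : Type} (f : ι → ZdIdx d L),
      (∀ (jf : ι) (c : CubeB8 d L (f jf).k (f jf).Ω),
      (∀ α₀ α₂ : ℝ, 0 < α₀ → α₀ ≤ cB9 → 0 < α₂ → α₂ ≤ cB9 →
      ∀ (U₀ W : Site d → Fin d → 𝔸ˣ), (∀ x κ, U₀ x κ ∈ unitaryUnits 𝔸) → (∀ x κ, W x κ ∈ unitaryUnits 𝔸) →
      InAk L c.k (f jf).η α₀ (cubeFam false L c.a c.M c.ρ c.k) U₀ → InAk L c.k (f jf).η α₀ (cubeFam false L c.a c.M c.ρ c.k) (mulCfg W U₀) → IsLandau138W L c.k (f jf).η ((cubeFam false L c.a c.M c.ρ c.k) 0) (cubeLamS L c.a c.M c.ρ c.k c.k) U₀ W →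
      ∀ A' : Site d → Fin d → 𝔸, (∀ y τ, IsSelfAdjoint (A' y τ)) →
      (∀ j, j ≤ c.k → ∀ (y : Site d) (τ : Fin d), SideTouches ((cubeFam false L c.a c.M c.ρ c.k) j) y τ →
      W y τ = cfgExp (f jf).η A' y τ ∧ ‖A' y τ‖ ≤ α₂ * ((L : ℝ) ^ j * (f jf).η)⁻¹) →
      (∀ (y : Site d) (τ : Fin d), (∀ j, j ≤ c.k → ¬ SideTouches ((cubeFam false L c.a c.M c.ρ c.k) j) y τ) → A' y τ = 0) →
      msup L c.k (f jf).η (-(1 : ℝ)) (fun j (b : Site d × Fin d) => SideTouches ((cubeFam false L c.a c.M c.ρ c.k) j) b.1 b.2) (fun b => A' b.1 b.2)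
      ≤ inp.B₀ * (bondNorm L c.k (f jf).η (-(3 : ℝ)) (cubeFam false L c.a c.M c.ρ c.k) (fun x μ => Jcur (f jf).η U₀ A' μ x)
      + wsup 1 (fun p : {p : ℕ × (Site d × Fin d) // p.1 ≤ c.k ∧ p.2 ∈ cubeLamB L c.a c.M c.ρ c.k c.k p.1} =>
      linCovIter L U₀ (iEta (f jf).η A') p.1.1 p.1.2.1 p.1.2.2)) + Bbd * msup L c.k (f jf).η (-(1 : ℝ))
      (fun j (b : Site d × Fin d) => j = 0 ∧ SideTouches ((cubeFam false L c.a c.M c.ρ c.k) 0) b.1 b.2 ∧ ¬ (b.1 ∈ (cubeFam false L c.a c.M c.ρ c.k) 0 ∧ b.1 + e b.2 ∈ (cubeFam false L c.a c.M c.ρ c.k) 0))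
      (fun b => A' b.1 b.2) ∧
      msup L c.k (f jf).η (-(2 : ℝ)) (fun j (t : Fin d × Fin d × Site d) => SideTouches ((cubeFam false L c.a c.M c.ρ c.k) j) t.2.2 t.2.1)
      (fun t => covDerivFwd (f jf).η U₀ t.1 (fun z => A' z t.2.1) t.2.2)
      ≤ inp.B₀ * (bondNorm L c.k (f jf).η (-(3 : ℝ)) (cubeFam false L c.a c.M c.ρ c.k) (fun x μ => Jcur (f jf).η U₀ A' μ x)
      + wsup 1 (fun p : {p : ℕ × (Site d × Fin d) // p.1 ≤ c.k ∧ p.2 ∈ cubeLamB L c.a c.M c.ρ c.k c.k p.1} =>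
      linCovIter L U₀ (iEta (f jf).η A') p.1.1 p.1.2.1 p.1.2.2)) + Bbd * msup L c.k (f jf).η (-(1 : ℝ))
      (fun j (b : Site d × Fin d) => j = 0 ∧ SideTouches ((cubeFam false L c.a c.M c.ρ c.k) 0) b.1 b.2 ∧ ¬ (b.1 ∈ (cubeFam false L c.a c.M c.ρ c.k) 0 ∧ b.1 + e b.2 ∈ (cubeFam false L c.a c.M c.ρ c.k) 0))
      (fun b => A' b.1 b.2) ∧
      bondNorm L c.k (f jf).η (-(3 : ℝ)) (cubeFam false L c.a c.M c.ρ c.k) (fun x μ => pdiv (f jf).η U₀ (plaqCovDeriv (f jf).η U₀ A') μ x)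
      ≤ inp.B₀ * (bondNorm L c.k (f jf).η (-(3 : ℝ)) (cubeFam false L c.a c.M c.ρ c.k) (fun x μ => Jcur (f jf).η U₀ A' μ x)
      + wsup 1 (fun p : {p : ℕ × (Site d × Fin d) // p.1 ≤ c.k ∧ p.2 ∈ cubeLamB L c.a c.M c.ρ c.k c.k p.1} =>
      linCovIter L U₀ (iEta (f jf).η A') p.1.1 p.1.2.1 p.1.2.2)) + Bbd * msup L c.k (f jf).η (-(1 : ℝ))
      (fun j (b : Site d × Fin d) => j = 0 ∧ SideTouches ((cubeFam false L c.a c.M c.ρ c.k) 0) b.1 b.2 ∧ ¬ (b.1 ∈ (cubeFam false L c.a c.M c.ρ c.k) 0 ∧ b.1 + e b.2 ∈ (cubeFam false L c.a c.M c.ρ c.k) 0))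
      (fun b => A' b.1 b.2) ∧
      bondNorm L c.k (f jf).η (-(3 : ℝ)) (cubeFam false L c.a c.M c.ρ c.k) (fun x μ => covLap (f jf).η U₀ (fun z => A' z μ) x)
      ≤ inp.B₀ * (bondNorm L c.k (f jf).η (-(3 : ℝ)) (cubeFam false L c.a c.M c.ρ c.k) (fun x μ => Jcur (f jf).η U₀ A' μ x)
      + wsup 1 (fun p : {p : ℕ × (Site d × Fin d) // p.1 ≤ c.k ∧ p.2 ∈ cubeLamB L c.a c.M c.ρ c.k c.k p.1} =>
      linCovIter L U₀ (iEta (f jf).η A') p.1.1 p.1.2.1 p.1.2.2)) + Bbd * msup L c.k (f jf).η (-(1 : ℝ))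
      (fun j (b : Site d × Fin d) => j = 0 ∧ SideTouches ((cubeFam false L c.a c.M c.ρ c.k) 0) b.1 b.2 ∧ ¬ (b.1 ∈ (cubeFam false L c.a c.M c.ρ c.k) 0 ∧ b.1 + e b.2 ∈ (cubeFam false L c.a c.M c.ρ c.k) 0))
      (fun b => A' b.1 b.2))) →
      B8.Prop6Printed d (L : ℝ) (5 * (d : ℝ) * L * inp.B₀) c₁ (fun j => zdCub 𝔸 L (f j)) := by
  obtain ⟨c₁, hc₁, G⟩ := gaugedBoundB8_cubeMember_of_thm4_b9DP_d4 (𝔸 := 𝔸) hd2 hL inp hC₂ hcB9 hBbd hBd β len H4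
  refine ⟨c₁, hc₁, fun f S => ?_⟩
  rw [prop6Printed_zdCub_iff]
  intro j α₀ hα U₀ hInA c hs
  exact G (f j).η (f j).hη c (S j c) U₀.1 U₀.2 α₀ hα hInA hs

#print axioms prop6Printed_zdCub_of_thm4_b9DP_d4

end Literature.MathematicalPhysics.QuantumFieldTheory.Balaban1983to89.B8Prop6CubeMemberGaugedBdryP

end
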